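import Mathlib
import Summits.NavierStokesRegularity.NavierStokesRegularity.Theses.ClockStretchingLaw
import Summits.NavierStokesRegularity.NavierStokesRegularity.Theorems.SymmetryModuliCountStretchingCertificateComparison
import Literature.Analysis.FluidPDE.TypeIAncientMild
import Literature.Analysis.FluidPDE.CurlFreeLiouville
import Literature.Analysis.FluidPDE.LerayProfileCalculus
import HarnessLib

/-!
# Route ClockStretchingLaw — the small-strain rung (`SmallStrainRung`)

Theorems file closing the support item stmt-NavierStokesRegularity-10574
(`Summit.NavierStokesRegularity.NavierStokesRegularity.Theses.ClockStretchingLaw.SmallStrainRung`):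
**a smooth divergence-free KNSS-mild ancient field `u` on `ℝ³ × (−∞, 0)` with the Type-I
temporal bound `|u| ≤ C/√(−t)` and the gauge strain bound `(−t)‖∇u(t)‖_{op,∞} ≤ ½` vanishes
identically.**

## Proof

The hypotheses are literally the class `IsTypeIAncientMild C u` (the Oseen–Koch–Tataru kernel
written out through `UnboundedOperators.heatKernel` is `FluidPDE.oseenKernel` by `rfl`). The
constant weight `h ≡ 1` with `δ = ½`, `A = 0` is a stretching certificate in the sense of route
`SymmetryModuliCount` (tree theorem `stretchCert_curl_eq_zero`): wherever `ω ≠ 0`,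
`(−t)(⟪∇u ξ, ξ⟫ − |∇ξ|²_F) − 1 + ½ ≤ (−t)‖∇u‖ − ½ ≤ 0 = (−t)(∂ₜ1 + u·∇1 − Δ1)`.
Hence `curl u ≡ 0` (vorticity maximum principle in the weighted form of that file), every slice is
a bounded curl- and divergence-free `C²` field, hence constant
(`eq_of_curl_eq_zero_of_isDivFree_of_bounded`, KNSS 2009 Lemma 3.1), and the KNSS gauge kills
slice-constant elements of the class (`IsTypeIAncientMild.eq_zero_of_slice_const`, KNSS 2009
Remark 6.1).

## References

* G. Koch, N. Nadirashvili, G. Seregin, V. Šverák, Acta Math. 203 (2009) 83–105, Lemma 3.1,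
  Remark 6.1. [KochNadirashviliSereginSverak2009]
* P. Constantin, C. Fefferman, Indiana Univ. Math. J. 42 (1993) 775–789, §1. [ConstantinFefferman1993]
-/

noncomputable section

-- the summit and its single sub-problem share the name (CONVENTIONS §1), as in every Theorems file
set_option linter.dupNamespace false

open Set Function Filter
open scoped RealInnerProductSpace Laplacian ContDiff Topology

namespace Summit.NavierStokesRegularity.NavierStokesRegularity.Theorems

open Literature.Analysis Literature.Analysis.FluidPDE

/-- **The rung inequality.** If `‖L‖ ≤ (1/2)/(−t)` (`t < 0`) then for every vector `ξ` with
`‖ξ‖ ≤ 1` and every `F ≥ 0`,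
`((−t)(⟪L ξ, ξ⟫ − F) − 1 + ½) · 1 ≤ (−t) · (0 + 0 − 0)`: the constant weight `h ≡ 1` satisfies the
stretching-certificate inequality with `δ = ½`. [folklore] -/
theorem smallStrainRung_cert_ineq {t : ℝ} (ht : t < 0)
    {L : EuclideanSpace ℝ (Fin 3) →L[ℝ] EuclideanSpace ℝ (Fin 3)}
    (hL : ‖L‖ ≤ (1 / 2) / (-t)) {ξ : EuclideanSpace ℝ (Fin 3)} (hξ : ‖ξ‖ ≤ 1) {F : ℝ}
    (hF : 0 ≤ F) :
    ((-t) * (⟪L ξ, ξ⟫ - F) - 1 + 1 / 2) * (1 : ℝ) ≤ (-t) * ((0 : ℝ) + 0 - 0) := by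
  have ht0 : 0 < -t := neg_pos.2 ht
  have h1 : ⟪L ξ, ξ⟫ ≤ ‖L‖ := by
    calc ⟪L ξ, ξ⟫ ≤ ‖L ξ‖ * ‖ξ‖ := real_inner_le_norm _ _
      _ ≤ ‖L‖ * ‖ξ‖ * ‖ξ‖ := by
          exact mul_le_mul_of_nonneg_right (L.le_opNorm ξ) (norm_nonneg ξ)
      _ ≤ ‖L‖ * 1 * 1 := by
          have h0 : 0 ≤ ‖L‖ := norm_nonneg L
          have h0' : 0 ≤ ‖ξ‖ := norm_nonneg ξ
          nlinarith [mul_le_mul_of_nonneg_left hξ h0, mul_nonneg h0 h0']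
      _ = ‖L‖ := by ring
  have h2 : (-t) * ‖L‖ ≤ 1 / 2 := by
    have htne : t ≠ 0 := ht.ne
    have e : (-t) * ((1 / 2) / (-t)) = 1 / 2 := by field_simp
    calc (-t) * ‖L‖ ≤ (-t) * ((1 / 2) / (-t)) := mul_le_mul_of_nonneg_left hL ht0.le
      _ = 1 / 2 := e
  nlinarith [mul_le_mul_of_nonneg_left h1 ht0.le, mul_nonneg ht0.le hF]

/-- **The hypotheses of `SmallStrainRung` are the class `IsTypeIAncientMild C u`**: the
Oseen–Koch–Tataru kernel written out through `UnboundedOperators.heatKernel` in the route file is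
`FluidPDE.oseenKernel` by definition (Koch–Tataru 2001, §2 (5)–(8)). [cite: KochTataruAdvMath2001, §2 (5)–(8)] -/
theorem smallStrainRung_isTypeIAncientMild {C : ℝ}
    {u : ℝ → EuclideanSpace ℝ (Fin 3) → EuclideanSpace ℝ (Fin 3)}
    (hu : ContDiffOn ℝ (⊤ : ℕ∞) (Function.uncurry u) (Set.Iio 0 ×ˢ Set.univ) ∧
      (∀ t < 0, Literature.Analysis.FluidPDE.VectorCalculus.IsDivFree (u t)) ∧
      (∀ s t : ℝ, s < t → t < 0 → ∀ x, u t x =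
        Literature.Analysis.FluidPDE.heatFlow (u s) (t - s) x -
          ∫ τ in Set.Ioo s t, ∫ y,
            ((-(inner ℝ (x - y) (u τ y) / (2 * (t - τ)) *
                Literature.Analysis.UnboundedOperators.heatKernel (t - τ) (x - y))) • u τ y +
              (∫ σ in Set.Ioi (t - τ),
                  Literature.Analysis.UnboundedOperators.heatKernel σ (x - y) / (4 * σ ^ 2)) •
                (inner ℝ (x - y) (u τ y) • u τ y + inner ℝ (u τ y) (u τ y) • (x - y) +
                  inner ℝ (x - y) (u τ y) • u τ y) -
              ((∫ σ in Set.Ioi (t - τ),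
                  Literature.Analysis.UnboundedOperators.heatKernel σ (x - y) / (8 * σ ^ 3)) *
                (inner ℝ (x - y) (u τ y) * inner ℝ (x - y) (u τ y))) • (x - y))) ∧
      Literature.Analysis.FluidPDE.HasTypeITimeDecay C u) :
    IsTypeIAncientMild C u :=
  isTypeIAncientMild_iff.2 hu

/-- **Small-strain rung (route `ClockStretchingLaw`, item stmt-NavierStokesRegularity-10574):** a
smooth divergence-free KNSS-mild ancient field with `|u| ≤ C/√(−t)` and `(−t)‖∇u(t)‖ ≤ ½`
vanishes identically. The constant weight `h ≡ 1` (`δ = ½`, `A = 0`) is a stretching certificate,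
so the vorticity vanishes (`stretchCert_curl_eq_zero`, the weighted vorticity maximum principle of
route `SymmetryModuliCount`); bounded curl-free divergence-free slices are constant
(`eq_of_curl_eq_zero_of_isDivFree_of_bounded`, KNSS 2009 Lemma 3.1) and the KNSS gauge kills
slice-constant elements (`IsTypeIAncientMild.eq_zero_of_slice_const`, KNSS 2009 Remark 6.1). [cite: KochNadirashviliSereginSverak2009, Lemma 3.1 and Remark 6.1 (arXiv:0709.3599)] -/
theorem clockStretchingLaw_smallStrainRung_proof :
    Summit.NavierStokesRegularity.NavierStokesRegularity.Theses.ClockStretchingLaw.SmallStrainRung := by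
  unfold Summit.NavierStokesRegularity.NavierStokesRegularity.Theses.ClockStretchingLaw.SmallStrainRung
  intro C u hu hgrad t ht x
  have hu' : IsTypeIAncientMild C u := smallStrainRung_isTypeIAncientMild hu
  -- the constant certificate `h ≡ 1`, `δ = 1/2`, `A = 0`
  have hh : IsSmoothSpaceTimeOn (Iio 0) (fun (_ : ℝ) (_ : EuclideanSpace ℝ (Fin 3)) => (1 : ℝ)) :=
    contDiffOn_const
  have hh1 : ∀ s < (0 : ℝ), ∀ (y : EuclideanSpace ℝ (Fin 3)),
      1 ≤ (fun (_ : ℝ) (_ : EuclideanSpace ℝ (Fin 3)) => (1 : ℝ)) s y := fun _ _ _ => le_rfl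
  have hgrad1 : ∀ s < (0 : ℝ), ∀ (y : EuclideanSpace ℝ (Fin 3)),
      ‖fderiv ℝ ((fun (_ : ℝ) (_ : EuclideanSpace ℝ (Fin 3)) => (1 : ℝ)) s) y‖ ≤
        0 * (1 / Real.sqrt (-s) + ‖y‖ / (-s)) *
          (fun (_ : ℝ) (_ : EuclideanSpace ℝ (Fin 3)) => (1 : ℝ)) s y := by
    intro s _ y
    simp
  have hcert : ∀ s < (0 : ℝ), ∀ (y : EuclideanSpace ℝ (Fin 3)), curl (u s) y ≠ 0 →
      ((-s) * (⟪fderiv ℝ (u s) y (vorticityDirection (curl (u s)) y),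
          vorticityDirection (curl (u s)) y⟫
          - frobeniusNormSq (fderiv ℝ (vorticityDirection (curl (u s))) y)) - 1 + 1 / 2) *
          (fun (_ : ℝ) (_ : EuclideanSpace ℝ (Fin 3)) => (1 : ℝ)) s y ≤
        (-s) * (timeDeriv (fun (_ : ℝ) (_ : EuclideanSpace ℝ (Fin 3)) => (1 : ℝ)) s y +
          fderiv ℝ ((fun (_ : ℝ) (_ : EuclideanSpace ℝ (Fin 3)) => (1 : ℝ)) s) y (u s y) -
          (Δ ((fun (_ : ℝ) (_ : EuclideanSpace ℝ (Fin 3)) => (1 : ℝ)) s)) y) := by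
    intro s hs y hω
    have hξ : ‖vorticityDirection (curl (u s)) y‖ ≤ 1 := by
      rw [vorticityDirection_apply, norm_smul, norm_inv, norm_norm,
        inv_mul_cancel₀ (norm_ne_zero_iff.2 hω)]
    have htd : timeDeriv (fun (_ : ℝ) (_ : EuclideanSpace ℝ (Fin 3)) => (1 : ℝ)) s y = 0 := by
      simp [timeDeriv]
    have hfd : fderiv ℝ ((fun (_ : ℝ) (_ : EuclideanSpace ℝ (Fin 3)) => (1 : ℝ)) s) y (u s y) = 0 := by
      simp
    have hΔ : (Δ ((fun (_ : ℝ) (_ : EuclideanSpace ℝ (Fin 3)) => (1 : ℝ)) s)) y = 0 :=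
      laplacian_const_eq_zero (1 : ℝ) y
    rw [htd, hfd, hΔ]
    exact smallStrainRung_cert_ineq hs (hgrad s hs y) hξ (frobeniusNormSq_nonneg _)
  have hω : ∀ s < 0, ∀ y, curl (u s) y = 0 := fun s hs y =>
    stretchCert_curl_eq_zero hu' hh hh1 one_half_pos hgrad1 hcert hs y
  have hub : ∀ s < 0, ∀ y, u s y = u s 0 := fun s hs y =>
    eq_of_curl_eq_zero_of_isDivFree_of_bounded ((hu'.contDiff_slice hs).of_le (by norm_cast))
      (hω s hs) (hu'.isDivFree hs) (fun z => hu'.norm_le hs z) y 0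
  exact hu'.eq_zero_of_slice_const hub ht x

end Summit.NavierStokesRegularity.NavierStokesRegularity.Theorems

end
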